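import Literature.Analysis.UnboundedOperators.HeatKernel
import Mathlib.MeasureTheory.Measure.Haar.InnerProductSpace
import Mathlib.Analysis.InnerProductSpace.ProdL2
import HarnessLib

/-!
# Rotation invariance of the product heat-kernel (Gaussian) measure `G_t(x)G_t(y) dx dy`

Analysis/UnboundedOperators support file (all results proved, no definitions, no named facts) on
the path to the Gaussian Poincaré inequality for the heat-kernel measure (`heatKernel t`),
wanted for the spectral gap of `L = Δ + ½x·∇ + 1` behind the named facts
`Literature.Analysis.FluidPDE.GallayWayne2006_thm11` / `GallayMaekawa2016_thm41`.

For a finite-dimensional real inner product space `E`, `a² + b² = 1` and the "rotation mixing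
the two factors" `R_{a,b}(x, y) = (a x + b y, −b x + a y)` of `E × E`:

* `exists_prodRotation`: `R_{a,b}` is (the underlying map of) a linear isometry equivalence of
  the `L²`-product `WithLp 2 (E × E)`;
* `integral_comp_prodRotation`: **Lebesgue measure on `E × E` is `R_{a,b}`-invariant**,
  `∫ F(R_{a,b} p) dp = ∫ F(p) dp` for every `F` (no integrability needed), by
  `LinearIsometryEquiv.measurePreserving` on `WithLp 2 (E × E)` and
  `WithLp.volume_preserving_ofLp`;
* `heatKernel_mul_heatKernel_prodRotation`: `G_t(ax+by) G_t(−bx+ay) = G_t(x) G_t(y)`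
  (`‖ax+by‖² + ‖−bx+ay‖² = ‖x‖² + ‖y‖²`);
* `integral_comp_prodRotation_mul_heatKernel` — **the Gaussian product measure is rotation
  invariant**: `∬ h(R_{a,b}(x,y)) G_t(x)G_t(y) = ∬ h(x,y) G_t(x)G_t(y)`; and the marginal
  identity `integral_comp_prodRotation_fst_mul_heatKernel`:
  `∬ φ(ax + by) G_t(x)G_t(y) = ∫ φ G_t` (`0 < t`), i.e. `aX + bY ∼ X` for independent
  `X, Y ∼ G_t(x)dx` — the Gaussian stability used in the interpolation proof of the Poincaré
  inequality.

## References

* D. Bakry, I. Gentil, M. Ledoux, *Analysis and Geometry of Markov Diffusion Operators*,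
  Springer 2014, §4.1; V. I. Bogachev, *Gaussian Measures*, AMS 1998, §1.2 (rotation invariance
  of product Gaussian measures). [folklore]
-/

open MeasureTheory Filter Topology Set InnerProductSpace Metric WithLp
open scoped Real RealInnerProductSpace

noncomputable section

namespace Literature.Analysis.UnboundedOperators

section Rotation

variable {E : Type*} [NormedAddCommGroup E] [InnerProductSpace ℝ E]

/-- `‖ax + by‖² + ‖−bx + ay‖² = ‖x‖² + ‖y‖²` for `a² + b² = 1`. [folklore] -/
theorem norm_sq_prodRotation (a b : ℝ) (h : a ^ 2 + b ^ 2 = 1) (x y : E) :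
    ‖a • x + b • y‖ ^ 2 + ‖-b • x + a • y‖ ^ 2 = ‖x‖ ^ 2 + ‖y‖ ^ 2 := by
  rw [norm_add_sq_real, norm_add_sq_real, norm_smul, norm_smul, norm_smul, norm_smul,
    inner_smul_left, inner_smul_right, inner_smul_left, inner_smul_right, Real.norm_eq_abs,
    Real.norm_eq_abs, Real.norm_eq_abs, mul_pow, mul_pow, mul_pow, mul_pow, sq_abs, sq_abs,
    sq_abs]
  simp only [RCLike.conj_to_real]
  linear_combination (‖x‖ ^ 2 + ‖y‖ ^ 2) * h

/-- **The rotation mixing the two factors is a linear isometry of `WithLp 2 (E × E)`**: for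
`a² + b² = 1` there is `R : WithLp 2 (E × E) ≃ₗᵢ[ℝ] WithLp 2 (E × E)` with
`R(x, y) = (a x + b y, −b x + a y)`. [folklore] -/
theorem exists_prodRotation (a b : ℝ) (h : a ^ 2 + b ^ 2 = 1) :
    ∃ R : WithLp 2 (E × E) ≃ₗᵢ[ℝ] WithLp 2 (E × E), ∀ p,
      R p = toLp 2 (a • (ofLp p).1 + b • (ofLp p).2, -b • (ofLp p).1 + a • (ofLp p).2) := by
  let L : ℝ → WithLp 2 (E × E) →ₗ[ℝ] WithLp 2 (E × E) := fun c =>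
    { toFun := fun p => toLp 2 (a • (ofLp p).1 + c • (ofLp p).2, -c • (ofLp p).1 + a • (ofLp p).2)
      map_add' := fun p q => by
        conv_rhs => rw [← toLp_add]
        congr 1
        rw [WithLp.ofLp_add]
        ext
        · simp only [Prod.fst_add, Prod.snd_add, Prod.mk_add_mk]; module
        · simp only [Prod.fst_add, Prod.snd_add, Prod.mk_add_mk]; module
      map_smul' := fun r p => by
        rw [RingHom.id_apply]
        conv_rhs => rw [← toLp_smul]
        congr 1
        rw [WithLp.ofLp_smul]
        ext
        · simp only [Prod.smul_fst, Prod.smul_snd, Prod.smul_mk]; module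
        · simp only [Prod.smul_fst, Prod.smul_snd, Prod.smul_mk]; module }
  have hL : ∀ c p, L c p =
      toLp 2 (a • (ofLp p).1 + c • (ofLp p).2, -c • (ofLp p).1 + a • (ofLp p).2) :=
    fun c p => rfl
  have hLL : ∀ c p, L c (L (-c) p) = (a * a + c * c) • p := fun c p => by
    rw [hL, hL]
    simp only [neg_neg]
    rw [show (a * a + c * c) • p = toLp 2 ((a * a + c * c) • ofLp p) by simp]
    congr 1
    ext <;> simp only [Prod.smul_fst, Prod.smul_snd] <;> module
  refine ⟨LinearEquiv.isometryOfInner (LinearEquiv.ofLinear (L b) (L (-b)) ?_ ?_) ?_,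
    fun p => rfl⟩
  · ext1 p
    simp only [LinearMap.coe_comp, Function.comp_apply, LinearMap.id_coe, id_eq]
    rw [hLL, show a * a + b * b = 1 by nlinarith, one_smul]
  · ext1 p
    simp only [LinearMap.coe_comp, Function.comp_apply, LinearMap.id_coe, id_eq]
    have := hLL (-b) p
    rw [neg_neg] at this
    rw [this, show a * a + -b * -b = 1 by nlinarith, one_smul]
  · intro p q
    change ⟪L b p, L b q⟫ = ⟪p, q⟫
    simp only [hL, prod_inner_apply, inner_add_left, inner_add_right, inner_smul_left,
      inner_smul_right, RCLike.conj_to_real]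
    linear_combination (⟪(ofLp p).1, (ofLp q).1⟫ + ⟪(ofLp p).2, (ofLp q).2⟫) * h

variable [FiniteDimensional ℝ E] [MeasurableSpace E] [BorelSpace E]

/-- **Lebesgue measure on `E × E` is invariant under the rotations mixing the factors**:
`∫ F(ax + by, −bx + ay) d(x,y) = ∫ F d(x,y)` for `a² + b² = 1` and every `F` (no
integrability needed). [folklore] -/
theorem integral_comp_prodRotation (a b : ℝ) (h : a ^ 2 + b ^ 2 = 1) (F : E × E → ℝ) :
    ∫ p : E × E, F (a • p.1 + b • p.2, -b • p.1 + a • p.2) = ∫ p : E × E, F p := by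
  obtain ⟨R, hR⟩ := exists_prodRotation (E := E) a b h
  have hofLp : MeasurePreserving (@ofLp 2 (E × E)) := WithLp.volume_preserving_ofLp E E
  have hemb : MeasurableEmbedding (@ofLp 2 (E × E)) :=
    (MeasurableEquiv.toLp 2 (E × E)).symm.measurableEmbedding
  have h1 := hofLp.integral_comp hemb (fun p : E × E => F (a • p.1 + b • p.2, -b • p.1 + a • p.2))
  have h2 := hofLp.integral_comp hemb F
  have h3 := R.measurePreserving.integral_comp R.toHomeomorph.measurableEmbedding
    (fun q => F (ofLp q))
  rw [← h1, ← h2, ← h3]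
  congr 1
  funext q
  simp only [hR, ofLp_toLp]

omit [FiniteDimensional ℝ E] [MeasurableSpace E] [BorelSpace E] in
/-- The product Gaussian weight is rotation invariant:
`G_t(ax+by) G_t(−bx+ay) = G_t(x) G_t(y)` for `a² + b² = 1`. [folklore] -/
theorem heatKernel_mul_heatKernel_prodRotation (a b : ℝ) (h : a ^ 2 + b ^ 2 = 1) (t : ℝ)
    (x y : E) :
    heatKernel t (a • x + b • y) * heatKernel t (-b • x + a • y) =
      heatKernel t x * heatKernel t y := by
  simp only [heatKernel]
  rw [mul_mul_mul_comm, mul_mul_mul_comm _ (Real.exp _), ← Real.exp_add, ← Real.exp_add]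
  congr 2
  have := norm_sq_prodRotation a b h x y
  rw [neg_div, neg_div, neg_div, neg_div, ← neg_add, ← neg_add, ← add_div, ← add_div, this]

/-- **Rotation invariance of the product heat-kernel measure**: for `a² + b² = 1` and every
`h : E × E → ℝ`, `∬ h(ax+by, −bx+ay) G_t(x)G_t(y) = ∬ h(x,y) G_t(x)G_t(y)`. [folklore] -/
theorem integral_comp_prodRotation_mul_heatKernel (a b : ℝ) (hab : a ^ 2 + b ^ 2 = 1) (t : ℝ)
    (h : E × E → ℝ) :
    ∫ p : E × E, h (a • p.1 + b • p.2, -b • p.1 + a • p.2) * (heatKernel t p.1 * heatKernel t p.2) =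
      ∫ p : E × E, h p * (heatKernel t p.1 * heatKernel t p.2) := by
  rw [← integral_comp_prodRotation a b hab (fun p => h p * (heatKernel t p.1 * heatKernel t p.2))]
  congr 1
  funext p
  rw [heatKernel_mul_heatKernel_prodRotation a b hab]

/-- **Gaussian stability** (marginal of the rotation invariance): for `a² + b² = 1`, `0 < t`
and `φ : E → ℝ`, `∬ φ(ax + by) G_t(x)G_t(y) dxdy = ∫ φ G_t`: if `X, Y` are independent with
law `G_t(x)dx` then so is distributed `aX + bY`. [folklore] -/
theorem integral_comp_prodRotation_fst_mul_heatKernel (a b : ℝ) (hab : a ^ 2 + b ^ 2 = 1)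
    {t : ℝ} (ht : 0 < t) (φ : E → ℝ) :
    ∫ p : E × E, φ (a • p.1 + b • p.2) * (heatKernel t p.1 * heatKernel t p.2) =
      ∫ x, φ x * heatKernel t x := by
  have h := integral_comp_prodRotation_mul_heatKernel a b hab t (fun p : E × E => φ p.1)
  simp only at h
  rw [h]
  calc ∫ p : E × E, φ p.1 * (heatKernel t p.1 * heatKernel t p.2)
      = ∫ p : E × E, (φ p.1 * heatKernel t p.1) * heatKernel t p.2 := by
        congr 1; funext p; ring
    _ = (∫ x, φ x * heatKernel t x) * ∫ y, heatKernel t y :=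
        integral_prod_mul (fun x => φ x * heatKernel t x) (heatKernel t)
    _ = ∫ x, φ x * heatKernel t x := by rw [integral_heatKernel_eq_one_holds ht, mul_one]

end Rotation

end Literature.Analysis.UnboundedOperators
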